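import Summits.HodgeConjecture.HodgeConjecture.Theorems.P2StubU2lL2Realisation
import Summits.HodgeConjecture.HodgeConjecture.Theorems.H413SpectrumJunctionPin
import HarnessLib

/-!
# FLOOR-0, crux `H413`: the `L²` inputs (ℓ1)/(ℓ2) of the U2′ detection chain — cotangent-form coordinates are CONTINUOUS,
# square-integrable on `U(V)(F⁺)\U(V)(𝔸_{F⁺})`, and a non-zero form has a non-zero `L²`-class

Cell hodgecm-mathlib (D-0151), FLOOR 0; crux item H413 = stmt-HodgeConjecture-24833; F0P2-plan (g0) RULING 2026-08-30T22:16:17Z (3), seat F0P2-p01 (g0).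
The detection route to the parent stub U2′ `StubU2CohFormsSpectrumIsThetaAt` (★ `Theorems/H413SpectrumInterfaces`) eats, for a form
`f ∈ cohForms (archFactorOf F V)` and an automorphic measure `μ`:

* `continuous_apply_of_mem_cohForms` — the coordinate functions `x ↦ f x j` are CONTINUOUS on `U(V)(𝔸_{F⁺})`, in the verbatim binder shape of the
  `hcont` hypothesis of the junction files (★ `Theorems/H413SpectrumJunction(Pin)`: «continuity of coordinates is a hypothesis, supplied by programme
  P2»).  The content is ★ `P2StubU2lL2Realisation.continuous_of_mem_cohForms` (holomorphic germs along `ιinf` ⇒ the `U(2,1)`-slices are group functions of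
  holomorphic functions on the ball; smoothness and `K_c`-invariance assemble them on the adelic group); the degree hypothesis `4 ≤ [F:ℚ]` of the
  requested shape is not used;
* (ℓ1) `memLp_two_toQuotFun_of_mem_cohForms` — the descended coordinate `toQuotFun (f · j)` (`[g] ↦ f(g⁻¹) j`) is in `L²(μ)` for every finite `μ`
  (`4 ≤ [F:ℚ]` ⇒ the quotient is compact, ★ `SpectrumJunction.compactSpace_automorphicQuotient_adelicDatum`; ★ `SpectrumJunction.memLp_toQuotFun_pin`);
* (ℓ2) `exists_toLp_ne_zero` — if `f ≠ 0` then some coordinate class `(toQuotFun (f · j)).toLp ≠ 0` in `L²(μ)`: an automorphic measure is positive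
  on non-empty open sets (`IsAutomorphicMeasure` extends `IsOpenPosMeasure`) and two continuous functions agreeing a.e. agree
  (★ `SpectrumJunction.toLp_toQuotFun_ne_zero`).

THEOREMS ONLY (no `def`, no `sorry`, no named-fact hypothesis); `--supports stmt-HodgeConjecture-24833 --as helper`.  HC_CM is proved only modulo the
7 printed citations until rung 0 closes; this file discharges none of them.

## References
* [BorelJacquet1979] A. Borel, H. Jacquet, Corvallis PSPM 33.1, §4.2 (continuity / left `G(K)`-invariance of automorphic forms), §4.6 (`L²`).
* [GelfandGraevPiatetskiShapiro1969] Ch. 1 §2.3 (compact quotient).  [Borel1963] §5 (finite invariant measure).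
* Tree: ★ `Theorems/P2StubU2lL2Realisation` (continuity), ★ `Theorems/H413SpectrumJunction` / `H413SpectrumJunctionPin` (the `toQuotFun` calculus at the pin),
  ★ `Automorphic/UnitaryGroupCohomologicalForms` (`toQuotFun`), ★ `Theorems/H413CohFormsCarriers` (carriers).
-/

set_option autoImplicit false

-- the mandated namespace has the single-problem summit's repeated segment (`HodgeConjecture.HodgeConjecture`)
set_option linter.dupNamespace false

noncomputable section

namespace Summit.HodgeConjecture.HodgeConjecture.Cruxes.H413.CohFormsL2

open MeasureTheory NumberField Topology
open scoped ENNReal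
open Literature.NumberTheory.Automorphic
open Literature.NumberTheory.Automorphic.UnitaryGroup.CotangentForms (toQuotFun)
open Summit.HodgeConjecture.HodgeConjecture.Cruxes.H413.CohFormsCarriers
open Summit.HodgeConjecture.HodgeConjecture.Cruxes.H413.P2StubU2lL2Realisation (continuous_of_mem_cohForms)
open Summit.HodgeConjecture.HodgeConjecture.Cruxes.H413.SpectrumJunction (memLp_toQuotFun_pin toLp_toQuotFun_ne_zero
  leftInvariant_of_mem_cohForms_pin compactSpace_automorphicQuotient_adelicDatum)

/-! ## §1 Continuity of the coordinates -/

/-- **The coordinates of a `(1,0) ⊕ (0,1)` cotangent form for the factor of record are continuous on `U(V)(𝔸_{F⁺})`** — hypothesis-free form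
(★ `P2StubU2lL2Realisation.continuous_of_mem_cohForms`). [cite: BorelJacquet1979, §4.2] -/
theorem continuous_apply_of_mem_cohForms' {F : HodgeCM.CMField} {ι₁ : F →+* ℂ} {V : HodgeCM.HermSpace3 F ι₁}
    {f : (adelicDatum F V).Adelic → (Fin 2 → ℂ)} (hf : f ∈ cohForms (archFactorOf F V)) (j : Fin 2) :
    Continuous fun x => f x j :=
  (continuous_apply j).comp (continuous_of_mem_cohForms F V hf)

/-- **The `hcont` hypothesis of the junction, VERBATIM SHAPE** (`∀ F {ι₁} V, 4 ≤ [F:ℚ] → ∀ f ∈ cohForms (archFactorOf F V), ∀ j, Continuous (x ↦ f x j)`;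
the degree hypothesis is not used). [cite: BorelJacquet1979, §4.2] -/
theorem continuous_apply_of_mem_cohForms :
    ∀ (F : HodgeCM.CMField) {ι₁ : F →+* ℂ} (V : HodgeCM.HermSpace3 F ι₁), 4 ≤ Module.finrank ℚ F →
      ∀ f ∈ cohForms (archFactorOf F V), ∀ j : Fin 2, Continuous fun x => f x j :=
  fun _F _ _V _ _f hf j => continuous_apply_of_mem_cohForms' hf j

variable {F : HodgeCM.CMField} {ι₁ : F →+* ℂ} {V : HodgeCM.HermSpace3 F ι₁}

/-! ## §2 (ℓ1) square-integrability of the descended coordinates -/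

/-- **(ℓ1), every exponent**: for `4 ≤ [F:ℚ]` and a finite measure `μ` on the (compact) quotient, the descended coordinate `[g] ↦ f(g⁻¹) j` of
`f ∈ cohForms (archFactorOf F V)` is in `L^p(μ)`. [cite: GelfandGraevPiatetskiShapiro1969, Ch. 1 §2.3] [cite: BorelJacquet1979, §4.6] -/
theorem memLp_toQuotFun_of_mem_cohForms (h4 : 4 ≤ Module.finrank ℚ F) {μ : Measure (adelicDatum F V).automorphicQuotient}
    [IsFiniteMeasure μ] {f : (adelicDatum F V).Adelic → (Fin 2 → ℂ)} (hf : f ∈ cohForms (archFactorOf F V)) (j : Fin 2) (p : ℝ≥0∞) :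
    MemLp (toQuotFun (adelicDatum F V) fun g => f g j) p μ :=
  memLp_toQuotFun_pin h4 hf j (continuous_apply_of_mem_cohForms' hf j) p

/-- **(ℓ1)**: for `4 ≤ [F:ℚ]` and a finite (e.g. automorphic) measure `μ`, every descended coordinate of `f ∈ cohForms (archFactorOf F V)` is in `L²(μ)`.
[cite: GelfandGraevPiatetskiShapiro1969, Ch. 1 §2.3] [cite: BorelJacquet1979, §4.6] -/
theorem memLp_two_toQuotFun_of_mem_cohForms (h4 : 4 ≤ Module.finrank ℚ F) {μ : Measure (adelicDatum F V).automorphicQuotient}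
    [IsFiniteMeasure μ] {f : (adelicDatum F V).Adelic → (Fin 2 → ℂ)} (hf : f ∈ cohForms (archFactorOf F V)) :
    ∀ j : Fin 2, MemLp (toQuotFun (adelicDatum F V) fun g => f g j) 2 μ :=
  fun j => memLp_toQuotFun_of_mem_cohForms h4 hf j 2

/-! ## §3 (ℓ2) a non-zero form has a non-zero `L²`-class -/

/-- **A non-zero coordinate of a cotangent form has a non-zero class** in `L^p(μ)` whenever `μ` is positive on non-empty open sets (e.g. automorphic).
[cite: BorelJacquet1979, §4.6] -/
theorem toLp_toQuotFun_ne_zero_of_mem_cohForms {μ : Measure (adelicDatum F V).automorphicQuotient} [μ.IsOpenPosMeasure]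
    {f : (adelicDatum F V).Adelic → (Fin 2 → ℂ)} (hf : f ∈ cohForms (archFactorOf F V)) (j : Fin 2) (hj : (fun g => f g j) ≠ 0)
    {p : ℝ≥0∞} (hm : MemLp (toQuotFun (adelicDatum F V) fun g => f g j) p μ) :
    hm.toLp (toQuotFun (adelicDatum F V) fun g => f g j) ≠ 0 :=
  toLp_toQuotFun_ne_zero (fun γ hγ x => by simp only [leftInvariant_of_mem_cohForms_pin hf γ hγ x])
    (continuous_apply_of_mem_cohForms' hf j) hm hj

/-- **(ℓ2)**: for `4 ≤ [F:ℚ]`, an automorphic measure `μ` and a NON-ZERO `f ∈ cohForms (archFactorOf F V)`, some descended coordinate has a NON-ZERO class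
in `L²(μ)` (the automorphic measure is positive on non-empty open sets; continuous functions agreeing a.e. agree). [cite: BorelJacquet1979, §4.6] -/
theorem exists_toLp_ne_zero (h4 : 4 ≤ Module.finrank ℚ F) {μ : Measure (adelicDatum F V).automorphicQuotient}
    [(adelicDatum F V).IsAutomorphicMeasure μ] {f : (adelicDatum F V).Adelic → (Fin 2 → ℂ)} (hf : f ∈ cohForms (archFactorOf F V)) (hne : f ≠ 0) :
    ∃ (j : Fin 2) (h : MemLp (toQuotFun (adelicDatum F V) fun g => f g j) 2 μ), h.toLp (toQuotFun (adelicDatum F V) fun g => f g j) ≠ 0 := by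
  obtain ⟨x, hx⟩ := Function.ne_iff.1 hne
  obtain ⟨j, hj⟩ := Function.ne_iff.1 hx
  have hj' : (fun g => f g j) ≠ 0 := fun h0 => hj (by simpa using congrFun h0 x)
  exact ⟨j, memLp_two_toQuotFun_of_mem_cohForms h4 hf j, toLp_toQuotFun_ne_zero_of_mem_cohForms hf j hj' _⟩

/-- **(ℓ2), coordinatewise contrapositive**: if every descended coordinate class of `f ∈ cohForms (archFactorOf F V)` vanishes in `L²(μ)` then `f = 0`.
[cite: BorelJacquet1979, §4.6] -/
theorem eq_zero_of_forall_toLp_eq_zero (h4 : 4 ≤ Module.finrank ℚ F) {μ : Measure (adelicDatum F V).automorphicQuotient}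
    [(adelicDatum F V).IsAutomorphicMeasure μ] {f : (adelicDatum F V).Adelic → (Fin 2 → ℂ)} (hf : f ∈ cohForms (archFactorOf F V))
    (h0 : ∀ j : Fin 2, (memLp_two_toQuotFun_of_mem_cohForms (μ := μ) h4 hf j).toLp (toQuotFun (adelicDatum F V) fun g => f g j) = 0) : f = 0 := by
  by_contra hne
  obtain ⟨j, hm, hj⟩ := exists_toLp_ne_zero (μ := μ) h4 hf hne
  exact hj (h0 j)

end Summit.HodgeConjecture.HodgeConjecture.Cruxes.H413.CohFormsL2

end
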